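import Literature.Probability.RandomGraphs.PlantedCliqueProgramMatrix
import Literature.Probability.RandomGraphs.PlantedCliqueSpectralCore
import Literature.Probability.RandomGraphs.PlantedCliqueEventsNorm
import HarnessLib

/-!
# Planted clique: the AKS program recovers the planted set on the good event

The deterministic half of the analysis of the program `AKSProg.output` (the Alon–Krivelevich–
Sudakov algorithm, `PlantedCliqueProgram.lean`) on a planted instance
`w = encodeEdgeVec (plant S x)` with seed length `s = |S'|`, `S' ⊆ S`, `T = S ∖ S'`, `κ = |T|`,
`m = |seedNbhd S S' x|`.

**Theorem `decodeVertexSet_output_eq`.** If `S` is the unique maximum clique, `x` is off the bad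
degree event `badDeg S T` and off the bad norm event `badNormAt S (seedNbhd S S' x)`, and
`64 (12 √m + 1) ≤ κ`, `32 √κ ≤ 2ⁿ`, then the decoded output of the program is exactly `S`.

The file first does the bookkeeping between the functional program (naturals, lists) and the
analysis (`Fin n`, finsets):

* `candidate_nodup`, `lt_of_mem_candidate`, `mem_candidates_iff` — candidates are duplicate-free
  lists of vertices `< n`, enumerated over seed tuples, columns and sizes;
* for a seed `S' ⊆ S`: the sorted seed `seedList(S')` is a seed tuple (`seedList_mem_tuples`),
  the program's common neighbourhood of it is the sorted `seedNbhd S S' x`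
  (`commonNbrs_seedList`), whose `a`-th entry is the `a`-th vertex `Finset.orderEmbOfFin`
  lists (`getD_nbhdList`);
* `posMatrix_eq_signMatrix` — the program's iteration matrix on that list is the sign matrix of
  the planted graph pulled back to the positions (`SimpleGraph.comap`), so that
  `powerCol` is a column of its power (`powerCol_nbhdList_getD`).

Then the proof of the theorem: on the positions `Fin m` the program runs exact power iteration on
the sign matrix of the pulled-back planted graph; `spectral_core`
(`PlantedCliqueSpectralCore.lean`) provides a column `j` for which the program's top-`κ`
selection and `3κ/4` clean-up return the positions of `T`, so the candidate for
`(seed tuple, j, κ)` is a duplicate-free list with vertex set `S`; every clique candidate has at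
most `k` vertices with equality only for vertex set `S` (uniqueness), so `best` has vertex set
`S` (`best_toFinset_eq`).

The auxiliary objects (`seedList(S')`, `nbhdList(S, S', x)`, `nbhdGraph(S, S', x)`,
`finsetOfList(m, l)`, `plantedPos(S, S', x)`) are local notations, not declarations: this file
introduces no definitions and no named facts.

## References

* N. Alon, M. Krivelevich, B. Sudakov, *Finding a large hidden clique in a random graph*, Random
  Structures Algorithms 13 (1998) 457–466, §2.1, §2.2 (correctness of Algorithm A), §2.3
  (correctness of Algorithm B) [AlonKrivelevichSudakov1998].
-/

noncomputable section

open Finset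

namespace Literature.Probability.RandomGraphs.PlantedClique

namespace AKSProg

variable {n : ℕ}

/-! ### Candidates are duplicate-free lists of vertices -/

/-- Entries of the common neighbourhood list are `< n`. [folklore] -/
theorem lt_of_mem_commonNbrs {w : List Bool} {t : List ℕ} {v : ℕ} (hv : v ∈ commonNbrs n w t) :
    v < n := ((mem_commonNbrs_iff n w t v).1 hv).1

/-- Reading a duplicate-free list by position is injective. [folklore] -/
theorem getD_injective_of_nodup {L : List ℕ} (hL : L.Nodup) {a b : ℕ} (ha : a < L.length)
    (hb : b < L.length) (h : L.getD a 0 = L.getD b 0) : a = b := by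
  rw [List.getD_eq_getElem _ _ ha, List.getD_eq_getElem _ _ hb] at h
  exact (List.Nodup.getElem_inj_iff hL).1 h

/-- **Candidates are duplicate-free.** [folklore] -/
theorem candidate_nodup {s : ℕ} (w : List Bool) {t : List ℕ} (ht : t ∈ tuples n s) (j k' : ℕ) :
    (candidate n w t j k').Nodup := by
  obtain ⟨-, htnd, -, -⟩ := tuple_props ht
  set L := commonNbrs n w t with hL
  have hLnd : L.Nodup := commonNbrs_nodup n w t
  rw [candidate, ← hL, List.nodup_append]
  refine ⟨?_, htnd, ?_⟩
  · refine (cleanup_nodup n w L _ k').map_on fun a ha b hb hab => ?_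
    exact getD_injective_of_nodup hLnd ((mem_cleanup_iff n w L _ k' a).1 ha).1
      ((mem_cleanup_iff n w L _ k' b).1 hb).1 hab
  · intro v hv u hu huv
    subst huv
    rw [List.mem_map] at hv
    obtain ⟨a, ha, rfl⟩ := hv
    have ha' := ((mem_cleanup_iff n w L _ k' a).1 ha).1
    have hmem : L.getD a 0 ∈ L := by
      rw [List.getD_eq_getElem _ _ ha']; exact List.getElem_mem ha'
    exact ((mem_commonNbrs_iff n w t _).1 hmem).2.1 hu

/-- Entries of a candidate are `< n`. [folklore] -/
theorem lt_of_mem_candidate {s : ℕ} (w : List Bool) {t : List ℕ} (ht : t ∈ tuples n s) (j k' : ℕ)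
    {v : ℕ} (hv : v ∈ candidate n w t j k') : v < n := by
  obtain ⟨-, -, htlt, -⟩ := tuple_props ht
  rw [candidate, List.mem_append] at hv
  rcases hv with hv | hv
  · rw [List.mem_map] at hv
    obtain ⟨a, ha, rfl⟩ := hv
    have ha' := ((mem_cleanup_iff n w _ _ k' a).1 ha).1
    have hmem : (commonNbrs n w t).getD a 0 ∈ commonNbrs n w t := by
      rw [List.getD_eq_getElem _ _ ha']; exact List.getElem_mem ha'
    exact lt_of_mem_commonNbrs hmem
  · exact htlt v hv

/-- Membership in the candidate list. [folklore] -/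
theorem mem_candidates_iff {s : ℕ} (w : List Bool) (C : List ℕ) :
    C ∈ candidates n s w ↔ ∃ t ∈ tuples n s, ∃ j < n, ∃ k' < n, C = candidate n w t j (k' + 1) := by
  rw [candidates]
  constructor
  · intro h
    obtain ⟨l, hl, hC⟩ := List.mem_flatten.1 h
    obtain ⟨t, ht, rfl⟩ := List.mem_map.1 hl
    obtain ⟨l', hl', hC'⟩ := List.mem_flatten.1 hC
    obtain ⟨j, hj, rfl⟩ := List.mem_map.1 hl'
    obtain ⟨k', hk', hCk⟩ := List.mem_map.1 hC'
    exact ⟨t, ht, j, List.mem_range.1 hj, k', List.mem_range.1 hk', hCk.symm⟩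
  · rintro ⟨t, ht, j, hj, k', hk', rfl⟩
    refine List.mem_flatten.2 ⟨_, List.mem_map.2 ⟨t, ht, rfl⟩, ?_⟩
    refine List.mem_flatten.2 ⟨_, List.mem_map.2 ⟨j, List.mem_range.2 hj, rfl⟩, ?_⟩
    exact List.mem_map.2 ⟨k', List.mem_range.2 hk', rfl⟩

/-! ### The seed tuple and the common neighbourhood list of a planted instance -/

/-- Notation (local, not a declaration): the seed tuple `seedList(S')`, the sorted list of the
seed `S'`, as naturals. -/
local notation3 (prettyPrint := false) "seedList(" S' ")" =>
  Finset.sort (Finset.map Fin.valEmbedding S') (· ≤ ·)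

/-- Notation (local, not a declaration): the common neighbourhood list `nbhdList(S, S', x)`, the
sorted `seedNbhd S S' x`, as naturals. -/
local notation3 (prettyPrint := false) "nbhdList(" S ", " S' ", " x ")" =>
  Finset.sort (Finset.map Fin.valEmbedding (seedNbhd S S' x)) (· ≤ ·)

/-- Membership in `seedList`. [folklore] -/
theorem mem_seedList {S' : Finset (Fin n)} {v : ℕ} : v ∈ seedList(S') ↔ ∃ h : v < n, (⟨v, h⟩ : Fin n) ∈ S' := by
  rw [Finset.mem_sort, Finset.mem_map]
  constructor
  · rintro ⟨z, hz, rfl⟩; exact ⟨z.isLt, by simpa using hz⟩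
  · rintro ⟨h, hv⟩; exact ⟨⟨v, h⟩, hv, rfl⟩

/-- Membership in `nbhdList`. [folklore] -/
theorem mem_nbhdList {S S' : Finset (Fin n)} {x : EdgeVec n} {v : ℕ} :
    v ∈ nbhdList(S, S', x) ↔ ∃ h : v < n, (⟨v, h⟩ : Fin n) ∈ seedNbhd S S' x := by
  rw [Finset.mem_sort, Finset.mem_map]
  constructor
  · rintro ⟨z, hz, rfl⟩; exact ⟨z.isLt, by simpa using hz⟩
  · rintro ⟨h, hv⟩; exact ⟨⟨v, h⟩, hv, rfl⟩

/-- The seed list is a seed tuple of length `|S'|`. [folklore] -/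
theorem seedList_mem_tuples (S' : Finset (Fin n)) : seedList(S') ∈ tuples n S'.card :=
  sort_mem_tuples (by rw [Finset.card_map]) fun v hv => by
    rw [Finset.mem_map] at hv
    obtain ⟨z, -, rfl⟩ := hv
    exact z.isLt

/-- **The program's common neighbourhood of the seed tuple is the sorted `seedNbhd`.**
[cite: AlonKrivelevichSudakov1998, §2.3 (`N*(S)`)] -/
theorem commonNbrs_seedList (S S' : Finset (Fin n)) (x : EdgeVec n) :
    commonNbrs n (encodeEdgeVec (plant S x)) (seedList(S')) = nbhdList(S, S', x) := by
  refine (commonNbrs_sorted n _ _).sortedLT.eq_of_mem_iff (Finset.sortedLT_sort _) fun v => ?_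
  rw [mem_commonNbrs_iff, mem_nbhdList]
  constructor
  · rintro ⟨hvn, hvt, hadj⟩
    refine ⟨hvn, mem_seedNbhd.2 ⟨fun h => hvt (mem_seedList.2 ⟨hvn, h⟩), fun u hu => ?_⟩⟩
    have := hadj u.val (mem_seedList.2 ⟨u.isLt, by simpa using hu⟩)
    exact (adj_encodeEdgeVec_nat _ hvn u.isLt).1 this
  · rintro ⟨hvn, hv⟩
    obtain ⟨hvS', hadj⟩ := mem_seedNbhd.1 hv
    refine ⟨hvn, fun h => ?_, fun u hu => ?_⟩
    · obtain ⟨h', hmem⟩ := mem_seedList.1 h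
      exact hvS' hmem
    · obtain ⟨hun, hu'⟩ := mem_seedList.1 hu
      exact (adj_encodeEdgeVec_nat _ hvn hun).2 (hadj _ hu')

/-- The sorted list of a set of `Fin n`, as naturals, is the `val`-image of the sorted list.
[folklore] -/
theorem sort_map_valEmbedding (V₀ : Finset (Fin n)) :
    (V₀.map Fin.valEmbedding).sort (· ≤ ·) = (V₀.sort (· ≤ ·)).map Fin.val := by
  refine (Finset.sortedLT_sort _).eq_of_mem_iff ?_ fun v => ?_
  · exact ((Finset.sortedLT_sort V₀).pairwise.map Fin.val fun a b h => h).sortedLT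
  · rw [Finset.mem_sort, Finset.mem_map, List.mem_map]
    simp only [Finset.mem_sort, Fin.valEmbedding_apply]

/-- The common neighbourhood list has length `|seedNbhd|`. [folklore] -/
theorem length_nbhdList (S S' : Finset (Fin n)) (x : EdgeVec n) :
    (nbhdList(S, S', x)).length = (seedNbhd S S' x).card := by
  rw [Finset.length_sort, Finset.card_map]

/-- The common neighbourhood list has no duplicates. [folklore] -/
theorem nbhdList_nodup (S S' : Finset (Fin n)) (x : EdgeVec n) : (nbhdList(S, S', x)).Nodup :=
  Finset.sort_nodup _ _

/-- **Positions of the list are the vertices listed by `Finset.orderEmbOfFin`.** [folklore] -/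
theorem getD_nbhdList {S S' : Finset (Fin n)} {x : EdgeVec n} {a : ℕ}
    (ha : a < (seedNbhd S S' x).card) :
    (nbhdList(S, S', x)).getD a 0 = ((seedNbhd S S' x).orderEmbOfFin rfl ⟨a, ha⟩ : Fin n) := by
  rw [sort_map_valEmbedding, Finset.orderEmbOfFin_apply,
    List.getD_eq_getElem _ _ (by rw [List.length_map, Finset.length_sort]; exact ha), List.getElem_map]
  rfl

/-- `Fin` form of the position reading. [folklore] -/
theorem fin_getD_nbhdList {S S' : Finset (Fin n)} {x : EdgeVec n} {a : ℕ}
    (ha : a < (seedNbhd S S' x).card) (h : (nbhdList(S, S', x)).getD a 0 < n) :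
    (⟨(nbhdList(S, S', x)).getD a 0, h⟩ : Fin n) = (seedNbhd S S' x).orderEmbOfFin rfl ⟨a, ha⟩ :=
  Fin.ext (getD_nbhdList ha)

/-- Entries of the common neighbourhood list are `< n`. [folklore] -/
theorem getD_nbhdList_lt {S S' : Finset (Fin n)} {x : EdgeVec n} {a : ℕ}
    (ha : a < (seedNbhd S S' x).card) : (nbhdList(S, S', x)).getD a 0 < n := by
  rw [getD_nbhdList ha]; exact Fin.isLt _

/-! ### The iteration matrix is the sign matrix of the pulled-back planted graph -/

/-- Notation (local, not a declaration): `nbhdGraph(S, S', x)`, the planted graph pulled back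
(`SimpleGraph.comap`) to the positions `Fin |seedNbhd S S' x|` of the common neighbourhood list —
the induced subgraph `G[N*(S)]` of [AlonKrivelevichSudakov1998, §2.3]. -/
local notation3 (prettyPrint := false) "nbhdGraph(" S ", " S' ", " x ")" =>
  SimpleGraph.comap (fun a => ((seedNbhd S S' x).orderEmbOfFin rfl a : Fin _))
    (graphOfEdgeVec (plant S x))

/-- Adjacency in the pulled-back graph. [folklore] -/
theorem nbhdGraph_adj {S S' : Finset (Fin n)} {x : EdgeVec n} {a b : Fin (seedNbhd S S' x).card} :
    (nbhdGraph(S, S', x)).Adj a b ↔ (graphOfEdgeVec (plant S x)).Adj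
      ((seedNbhd S S' x).orderEmbOfFin rfl a) ((seedNbhd S S' x).orderEmbOfFin rfl b) :=
  SimpleGraph.comap_adj

/-- The program's adjacency between two positions of the list is adjacency in the pulled-back
graph. [folklore] -/
theorem adj_getD_nbhdList_iff {S S' : Finset (Fin n)} {x : EdgeVec n}
    (a b : Fin (seedNbhd S S' x).card) :
    adj n (encodeEdgeVec (plant S x)) ((nbhdList(S, S', x)).getD a 0) ((nbhdList(S, S', x)).getD b 0) = true
      ↔ (nbhdGraph(S, S', x)).Adj a b := by
  rw [nbhdGraph_adj, adj_encodeEdgeVec_nat _ (getD_nbhdList_lt a.isLt) (getD_nbhdList_lt b.isLt),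
    fin_getD_nbhdList a.isLt, fin_getD_nbhdList b.isLt]

/-- **The iteration matrix of the program is the sign matrix of the pulled-back graph.**
[cite: AlonKrivelevichSudakov1998, §2.1 (the adjacency matrix of `G[N*(S)]`)] -/
theorem posMatrix_eq_signMatrix (S S' : Finset (Fin n)) (x : EdgeVec n)
    [DecidableRel (nbhdGraph(S, S', x)).Adj] :
    posMatrix n (encodeEdgeVec (plant S x)) (nbhdList(S, S', x)) (seedNbhd S S' x).card =
      signMatrix (nbhdGraph(S, S', x)) := by
  ext a b
  rw [posMatrix, Matrix.of_apply, signMatrix_apply, sgnEntry]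
  have hab : (nbhdList(S, S', x)).getD a 0 = (nbhdList(S, S', x)).getD b 0 ↔ a = b := by
    constructor
    · intro h
      exact Fin.ext (getD_injective_of_nodup (nbhdList_nodup S S' x)
        (by rw [length_nbhdList]; exact a.isLt) (by rw [length_nbhdList]; exact b.isLt) h)
    · rintro rfl; rfl
  by_cases h : a = b
  · rw [if_pos (hab.2 h), if_pos h]
  · rw [if_neg (fun h' => h (hab.1 h')), if_neg h]
    by_cases hadj : (nbhdGraph(S, S', x)).Adj a b
    · rw [if_pos ((adj_getD_nbhdList_iff a b).2 hadj), if_pos hadj]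
    · rw [if_neg (fun h' => hadj ((adj_getD_nbhdList_iff a b).1 h')), if_neg hadj]

/-- **The program's power iteration computes a column of the power of the sign matrix.**
[cite: AlonKrivelevichSudakov1998, §2.1 (step 1)] -/
theorem powerCol_nbhdList_getD (S S' : Finset (Fin n)) (x : EdgeVec n)
    [DecidableRel (nbhdGraph(S, S', x)).Adj] (t : ℕ) (a j : Fin (seedNbhd S S' x).card) :
    (powerCol n (encodeEdgeVec (plant S x)) (nbhdList(S, S', x)) j t).getD a 0 =
      (signMatrix (nbhdGraph(S, S', x)) ^ t) a j := by
  rw [powerCol_getD n _ _ (length_nbhdList S S' x) j.isLt t a.isLt, posMatrix_eq_signMatrix]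


/-! ### Lists of naturals below `m` versus finsets of `Fin m` -/

/-- Notation (local, not a declaration): `finsetOfList(m, l)`, the finset of `Fin m` cut out by
a list `l` of naturals. -/
local notation3 (prettyPrint := false) "finsetOfList(" m ", " l ")" =>
  Finset.filter (fun a : Fin m => (a : ℕ) ∈ l) Finset.univ

/-- Membership in `finsetOfList`. [folklore] -/
theorem mem_finsetOfList {m : ℕ} {l : List ℕ} {a : Fin m} : a ∈ finsetOfList(m, l) ↔ (a : ℕ) ∈ l := by
  simp

/-- The `val`-image of a sub-finset of `finsetOfList` filtered by `P` is the sub-list filtered by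
a matching Boolean test. [folklore] -/
theorem image_val_filter_finsetOfList {m : ℕ} (l : List ℕ) (hlt : ∀ b ∈ l, b < m) (p : ℕ → Bool)
    (P : Fin m → Prop) [DecidablePred P] (hpP : ∀ b : Fin m, (b : ℕ) ∈ l → (p b = true ↔ P b)) :
    ((finsetOfList(m, l)).filter P).image Fin.val = (l.filter p).toFinset := by
  ext b
  rw [mem_image, List.mem_toFinset, List.mem_filter]
  constructor
  · rintro ⟨a, ha, rfl⟩
    rw [mem_filter, mem_finsetOfList] at ha
    exact ⟨ha.1, (hpP a ha.1).2 ha.2⟩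
  · rintro ⟨hb, hpb⟩
    refine ⟨⟨b, hlt b hb⟩, ?_, rfl⟩
    rw [mem_filter, mem_finsetOfList]
    exact ⟨hb, (hpP ⟨b, hlt b hb⟩ hb).1 hpb⟩

/-- Lengths of filtered duplicate-free lists are cardinalities of filtered finsets. [folklore] -/
theorem length_filter_eq_card {m : ℕ} (l : List ℕ) (hl : l.Nodup) (hlt : ∀ b ∈ l, b < m)
    (p : ℕ → Bool) (P : Fin m → Prop) [DecidablePred P]
    (hpP : ∀ b : Fin m, (b : ℕ) ∈ l → (p b = true ↔ P b)) :
    (l.filter p).length = ((finsetOfList(m, l)).filter P).card := by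
  rw [← List.toFinset_card_of_nodup (hl.filter p), ← image_val_filter_finsetOfList l hlt p P hpP,
    card_image_of_injective _ Fin.val_injective]

/-- The finset of a duplicate-free list of naturals `< m` has the list's length. [folklore] -/
theorem card_finsetOfList {m : ℕ} (l : List ℕ) (hl : l.Nodup) (hlt : ∀ b ∈ l, b < m) :
    (finsetOfList(m, l)).card = l.length := by
  have h := length_filter_eq_card l hl hlt (fun _ => true) (fun _ => True) (fun _ _ => by simp)
  rw [List.filter_true, filter_true_of_mem fun _ _ => trivial] at h
  exact h.symm

/-! ### The positions of the planted vertices -/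

/-- Notation (local, not a declaration): `plantedPos(S, S', x)`, the positions, in the common
neighbourhood list, of the planted vertices (`= S ∖ S'`). -/
local notation3 (prettyPrint := false) "plantedPos(" S ", " S' ", " x ")" =>
  Finset.filter (fun a : Fin (Finset.card (seedNbhd S S' x)) =>
    ((seedNbhd S S' x).orderEmbOfFin rfl a : Fin _) ∈ S) Finset.univ

section Planted

variable {S S' : Finset (Fin n)} {x : EdgeVec n}

/-- Membership in `plantedPos`. [folklore] -/
theorem mem_plantedPos {a : Fin (seedNbhd S S' x).card} :
    a ∈ plantedPos(S, S', x) ↔ ((seedNbhd S S' x).orderEmbOfFin rfl a : Fin n) ∈ S := by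
  simp

/-- Every vertex of the common neighbourhood is listed. [folklore] -/
theorem exists_orderEmbOfFin_eq {v : Fin n} (hv : v ∈ seedNbhd S S' x) :
    ∃ a : Fin (seedNbhd S S' x).card, (seedNbhd S S' x).orderEmbOfFin rfl a = v := by
  have : v ∈ Set.range ((seedNbhd S S' x).orderEmbOfFin rfl) := by
    rw [Finset.range_orderEmbOfFin]; exact hv
  exact this

/-- The planted vertices of the common neighbourhood are `S ∖ S'`. [folklore] -/
theorem mem_seedNbhd_and_mem_iff (hS'S : S' ⊆ S) {v : Fin n} :
    v ∈ seedNbhd S S' x ∧ v ∈ S ↔ v ∈ S \ S' := by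
  rw [mem_sdiff]
  constructor
  · rintro ⟨hv, hvS⟩
    exact ⟨hvS, fun hvS' => Finset.disjoint_left.1 (disjoint_seedNbhd x) hv hvS'⟩
  · intro h
    exact ⟨sdiff_subset_seedNbhd hS'S x (mem_sdiff.2 h), h.1⟩

/-- The image of the planted positions with an adjacency condition. [folklore] -/
theorem image_plantedPos_filter (hS'S : S' ⊆ S) (P : Fin n → Prop) [DecidablePred P] :
    ((plantedPos(S, S', x)).filter fun a => P ((seedNbhd S S' x).orderEmbOfFin rfl a)).image
        (fun a => ((seedNbhd S S' x).orderEmbOfFin rfl a : Fin n)) =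
      (S \ S').filter P := by
  ext v
  rw [mem_image, mem_filter]
  constructor
  · rintro ⟨a, ha, rfl⟩
    rw [mem_filter, mem_plantedPos] at ha
    exact ⟨(mem_seedNbhd_and_mem_iff hS'S).1 ⟨Finset.orderEmbOfFin_mem _ _ _, ha.1⟩, ha.2⟩
  · rintro ⟨hv, hPv⟩
    obtain ⟨hvN, hvS⟩ := (mem_seedNbhd_and_mem_iff (x := x) hS'S).2 hv
    obtain ⟨a, rfl⟩ := exists_orderEmbOfFin_eq hvN
    exact ⟨a, mem_filter.2 ⟨mem_plantedPos.2 hvS, hPv⟩, rfl⟩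

/-- **`|plantedPos| = |S ∖ S'|`.** [folklore] -/
theorem card_plantedPos (hS'S : S' ⊆ S) : (plantedPos(S, S', x)).card = (S \ S').card := by
  classical
  have h := image_plantedPos_filter (x := x) hS'S (fun _ => True)
  rw [filter_true_of_mem (fun _ _ => trivial), filter_true_of_mem (fun _ _ => trivial)] at h
  rw [← h, card_image_of_injective _ ((seedNbhd S S' x).orderEmbOfFin rfl).injective]

/-- The planted positions form a clique of the pulled-back graph. [folklore] -/
theorem isClique_plantedPos : (nbhdGraph(S, S', x)).IsClique (plantedPos(S, S', x) : Set _) := by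
  intro a ha b hb hab
  rw [mem_coe, mem_plantedPos] at ha hb
  rw [nbhdGraph_adj]
  exact isClique_plant S x ha hb (((seedNbhd S S' x).orderEmbOfFin rfl).injective.ne hab)

/-- **The random part on the good norm event** is the hypothesis `hR` of `spectral_core` for the
pulled-back graph. [cite: AlonKrivelevichSudakov1998, §2.2 (Lemma 2.2)] -/
theorem spike_hR_of_not_mem_badNormAt [DecidableRel (nbhdGraph(S, S', x)).Adj]
    (hnorm : x ∉ badNormAt S (seedNbhd S S' x)) (a b : EuclideanSpace ℝ (Fin (seedNbhd S S' x).card)) :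
    ∑ i, ∑ j, (if i ∈ plantedPos(S, S', x) ∧ j ∈ plantedPos(S, S', x) then 0
        else (signMatrix (nbhdGraph(S, S', x))).map (Int.cast : ℤ → ℝ) i j) * a i * b j ≤
      12 * Real.sqrt (seedNbhd S S' x).card * ‖a‖ * ‖b‖ := by
  classical
  rw [badNormAt, mem_filter, not_and] at hnorm
  have h := not_not.1 (hnorm (mem_univ _)) a b
  refine le_trans (le_of_eq ?_) h
  refine sum_congr rfl fun i _ => sum_congr rfl fun j _ => ?_
  congr 2
  by_cases hS : ((seedNbhd S S' x).orderEmbOfFin rfl i : Fin n) ∈ S ∧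
      ((seedNbhd S S' x).orderEmbOfFin rfl j : Fin n) ∈ S
  · have hij' : i ∈ plantedPos(S, S', x) ∧ j ∈ plantedPos(S, S', x) :=
      ⟨mem_plantedPos.2 hS.1, mem_plantedPos.2 hS.2⟩
    rw [if_pos hij']
    simp only [Rmat]
    rw [if_pos (Or.inr hS)]
  · have hij' : ¬ (i ∈ plantedPos(S, S', x) ∧ j ∈ plantedPos(S, S', x)) :=
      fun h => hS ⟨mem_plantedPos.1 h.1, mem_plantedPos.1 h.2⟩
    rw [if_neg hij', signMatrix_map_apply]
    simp only [Rmat]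
    by_cases hij : i = j
    · rw [if_pos hij, if_pos (Or.inl hij)]
    · rw [if_neg hij, if_neg (not_or.2 ⟨hij, hS⟩)]
      by_cases hadj : (graphOfEdgeVec (plant S x)).Adj ((seedNbhd S S' x).orderEmbOfFin rfl i)
          ((seedNbhd S S' x).orderEmbOfFin rfl j)
      · rw [if_pos (nbhdGraph_adj.2 hadj), if_pos hadj]
      · rw [if_neg (fun h => hadj (nbhdGraph_adj.1 h)), if_neg hadj]

/-- **Degrees on the good degree event** give the hypothesis `hdeg` of `spectral_core`.
[cite: AlonKrivelevichSudakov1998, §2.2 (last paragraph)] -/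
theorem hdeg_of_not_mem_badDeg [DecidableRel (nbhdGraph(S, S', x)).Adj] (hS'S : S' ⊆ S)
    (hdeg : x ∉ badDeg S (S \ S')) (v : Fin (seedNbhd S S' x).card) (hv : v ∉ plantedPos(S, S', x)) :
    (((plantedPos(S, S', x)).filter fun a => (nbhdGraph(S, S', x)).Adj v a).card : ℝ) <
      7 * (S \ S').card / 12 := by
  classical
  rw [mem_plantedPos] at hv
  have hat : x ∉ badDegAt S (S \ S') ((seedNbhd S S' x).orderEmbOfFin rfl v) := by
    intro h
    exact hdeg (mem_biUnion.2 ⟨_, mem_sdiff.2 ⟨mem_univ _, hv⟩, h⟩)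
  rw [mem_badDegAt, not_le] at hat
  have hcard : ((plantedPos(S, S', x)).filter fun a => (nbhdGraph(S, S', x)).Adj v a).card =
      ((S \ S').filter fun u => (graphOfEdgeVec (plant S x)).Adj
        ((seedNbhd S S' x).orderEmbOfFin rfl v) u).card := by
    have h := image_plantedPos_filter (x := x) hS'S
      (fun u => (graphOfEdgeVec (plant S x)).Adj ((seedNbhd S S' x).orderEmbOfFin rfl v) u)
    rw [← card_image_of_injective _ ((seedNbhd S S' x).orderEmbOfFin rfl).injective]
    have hf : ((plantedPos(S, S', x)).filter fun a => (nbhdGraph(S, S', x)).Adj v a) =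
        (plantedPos(S, S', x)).filter fun a => (graphOfEdgeVec (plant S x)).Adj
          ((seedNbhd S S' x).orderEmbOfFin rfl v) ((seedNbhd S S' x).orderEmbOfFin rfl a) :=
      filter_congr fun a _ => nbhdGraph_adj
    rw [hf, h]
  rw [hcard]
  convert hat using 3

end Planted

/-! ### The good candidate -/

section GoodCandidate

variable {S S' : Finset (Fin n)} {x : EdgeVec n}

/-- On the conclusion of `spectral_core`, the program's clean-up returns the planted positions.
[cite: AlonKrivelevichSudakov1998, §2.2 (end of the analysis of Algorithm A)] -/
theorem mem_cleanup_iff_mem_plantedPos [DecidableRel (nbhdGraph(S, S', x)).Adj] {Wl : List ℕ}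
    (hWlt : ∀ b ∈ Wl, b < (seedNbhd S S' x).card) (hWnd : Wl.Nodup) {κ : ℕ}
    (hfilter : (univ.filter fun v : Fin (seedNbhd S S' x).card => 3 * κ ≤
        4 * ((finsetOfList(_, Wl)).filter fun b => (nbhdGraph(S, S', x)).Adj v b).card) = plantedPos(S, S', x))
    (a : Fin (seedNbhd S S' x).card) :
    (a : ℕ) ∈ cleanup n (encodeEdgeVec (plant S x)) (nbhdList(S, S', x)) Wl κ ↔ a ∈ plantedPos(S, S', x) := by
  rw [mem_cleanup_iff, length_nbhdList, ← hfilter, mem_filter]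
  have hlen : (Wl.filter fun b => adj n (encodeEdgeVec (plant S x)) ((nbhdList(S, S', x)).getD a 0)
      ((nbhdList(S, S', x)).getD b 0)).length =
      ((finsetOfList(_, Wl)).filter fun b => (nbhdGraph(S, S', x)).Adj a b).card :=
    length_filter_eq_card Wl hWnd hWlt _ _ fun b _ => adj_getD_nbhdList_iff a b
  rw [hlen]
  exact ⟨fun h => ⟨mem_univ _, h.2⟩, fun h => ⟨a.isLt, h.2⟩⟩

/-- The vertex set of the good candidate is `S` (as naturals), it is duplicate-free of length
`|S|` and passes the clique test. [cite: AlonKrivelevichSudakov1998, §2.3 (correctness of Algorithm B)] -/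
theorem good_candidate [DecidableRel (nbhdGraph(S, S', x)).Adj] (hS'S : S' ⊆ S) {Wl : List ℕ}
    (hWlt : ∀ b ∈ Wl, b < (seedNbhd S S' x).card) (hWnd : Wl.Nodup)
    (hfilter : (univ.filter fun v : Fin (seedNbhd S S' x).card => 3 * (S \ S').card ≤
        4 * ((finsetOfList(_, Wl)).filter fun b => (nbhdGraph(S, S', x)).Adj v b).card) = plantedPos(S, S', x))
    {j : ℕ} (hW : Wl = topPositions (powerCol n (encodeEdgeVec (plant S x)) (nbhdList(S, S', x)) j n)
      (S \ S').card) :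
    let C := candidate n (encodeEdgeVec (plant S x)) (seedList(S')) j (S \ S').card
    C.toFinset = S.map Fin.valEmbedding ∧ C.Nodup ∧ C.length = S.card ∧
      isClique n (encodeEdgeVec (plant S x)) C = true := by
  classical
  intro C
  have hnd : C.Nodup := candidate_nodup _ (seedList_mem_tuples S') _ _
  -- the vertex set
  have hset : ∀ v : ℕ, v ∈ C ↔ ∃ h : v < n, (⟨v, h⟩ : Fin n) ∈ S := by
    intro v
    show v ∈ candidate n (encodeEdgeVec (plant S x)) (seedList(S')) j (S \ S').card ↔ _
    rw [candidate, commonNbrs_seedList, ← hW, List.mem_append, List.mem_map, mem_seedList]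
    constructor
    · rintro (⟨a, ha, rfl⟩ | ⟨h, hv⟩)
      · have ham : a < (seedNbhd S S' x).card := by
          have := ((mem_cleanup_iff n _ _ _ _ a).1 ha).1
          rwa [length_nbhdList] at this
        have hmem := (mem_cleanup_iff_mem_plantedPos hWlt hWnd hfilter ⟨a, ham⟩).1 ha
        rw [mem_plantedPos] at hmem
        refine ⟨getD_nbhdList_lt ham, ?_⟩
        rw [fin_getD_nbhdList ham]
        exact hmem
      · exact ⟨h, hS'S hv⟩
    · rintro ⟨hvn, hvS⟩
      by_cases hvS' : (⟨v, hvn⟩ : Fin n) ∈ S'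
      · exact Or.inr ⟨hvn, hvS'⟩
      · left
        have hvN : (⟨v, hvn⟩ : Fin n) ∈ seedNbhd S S' x :=
          sdiff_subset_seedNbhd hS'S x (mem_sdiff.2 ⟨hvS, hvS'⟩)
        obtain ⟨a, ha⟩ := exists_orderEmbOfFin_eq hvN
        refine ⟨a, (mem_cleanup_iff_mem_plantedPos hWlt hWnd hfilter a).2 ?_, ?_⟩
        · rw [mem_plantedPos, ha]; exact hvS
        · rw [getD_nbhdList a.isLt, Fin.eta, ha]
  have htoFinset : C.toFinset = S.map Fin.valEmbedding := by
    ext v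
    rw [List.mem_toFinset, hset, Finset.mem_map]
    constructor
    · rintro ⟨h, hv⟩; exact ⟨⟨v, h⟩, hv, rfl⟩
    · rintro ⟨z, hz, rfl⟩; exact ⟨z.isLt, by simpa using hz⟩
  refine ⟨htoFinset, hnd, ?_, ?_⟩
  · rw [← List.toFinset_card_of_nodup hnd, htoFinset, card_map]
  · rw [isClique_eq_true_iff]
    intro a ha b hb
    by_cases hab : a = b
    · exact Or.inl hab
    · right
      obtain ⟨han, haS⟩ := (hset a).1 ha
      obtain ⟨hbn, hbS⟩ := (hset b).1 hb
      exact (adj_encodeEdgeVec_nat _ han hbn).2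
        (isClique_plant S x haS hbS (fun h => hab (Fin.mk.inj_iff.1 h)))

end GoodCandidate

/-! ### All clique candidates are small -/

/-- A clique candidate gives a clique of the planted graph with as many vertices.
[cite: AlonKrivelevichSudakov1998, §2.3 (Algorithm B, step 4)] -/
theorem clique_of_isClique {S : Finset (Fin n)} {x : EdgeVec n} {s : ℕ} {C : List ℕ}
    (hC : C ∈ candidates n s (encodeEdgeVec (plant S x)))
    (hcl : isClique n (encodeEdgeVec (plant S x)) C = true) :
    (graphOfEdgeVec (plant S x)).IsClique (finsetOfList(n, C) : Set (Fin n)) ∧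
      (finsetOfList(n, C)).card = C.length ∧ (finsetOfList(n, C)).image Fin.val = C.toFinset := by
  obtain ⟨t, ht, j, -, k', -, rfl⟩ := (mem_candidates_iff _ C).1 hC
  have hnd := candidate_nodup (encodeEdgeVec (plant S x)) ht j (k' + 1)
  have hlt : ∀ v ∈ candidate n (encodeEdgeVec (plant S x)) t j (k' + 1), v < n :=
    fun v hv => lt_of_mem_candidate _ ht j (k' + 1) hv
  refine ⟨?_, card_finsetOfList _ hnd hlt, ?_⟩
  · intro v hv u hu hvu
    rw [mem_coe, mem_finsetOfList] at hv hu
    rw [isClique_eq_true_iff] at hcl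
    rcases hcl v hv u hu with h | h
    · exact absurd (Fin.ext h) hvu
    · have := (adj_encodeEdgeVec_nat (plant S x) v.isLt u.isLt).1 h
      simpa using this
  · have h := image_val_filter_finsetOfList _ hlt (fun _ => true) (fun _ => True) (fun _ _ => by simp)
    rw [List.filter_true, filter_true_of_mem fun _ _ => trivial] at h
    exact h

/-- **Clique candidates have at most `|S|` vertices, with equality only for vertex set `S`**
(uniqueness of the maximum clique). [cite: AlonKrivelevichSudakov1998, §2.3 with §1 ("the unique largest clique")] -/
theorem clique_candidate_le {S : Finset (Fin n)} {x : EdgeVec n} {s : ℕ}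
    (hU : IsUniqueMaxClique (graphOfEdgeVec (plant S x)) S) {C : List ℕ}
    (hC : C ∈ candidates n s (encodeEdgeVec (plant S x)))
    (hcl : isClique n (encodeEdgeVec (plant S x)) C = true) :
    C.length ≤ S.card ∧ (C.length = S.card → C.toFinset = S.map Fin.valEmbedding) := by
  obtain ⟨hclique, hcard, himage⟩ := clique_of_isClique hC hcl
  have key : S.card ≤ (finsetOfList(n, C)).card → finsetOfList(n, C) = S := hU.2 _ hclique
  constructor
  · by_contra hlt
    push Not at hlt
    have h := key (by rw [hcard]; exact hlt.le)
    rw [← hcard, h] at hlt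
    exact lt_irrefl _ hlt
  · intro heq
    have h := key (by rw [hcard, heq])
    rw [← himage, h]
    ext v
    simp [Finset.mem_map, Finset.mem_image]

/-! ### The program recovers the planted set -/

/-- **On the good event the AKS program outputs the planted set.** Let `S' ⊆ S`, `T = S ∖ S'`,
`κ = |T|`, `m = |seedNbhd S S' x|`. If `S` is the unique maximum clique of the planted graph, `x` is
off the bad degree event of `T` and off the bad norm event of the common neighbourhood, and
`64 (12 √m + 1) ≤ κ`, `32 √κ ≤ 2ⁿ`, then
`decodeVertexSet n (output |S'| (n, encodeEdgeVec (plant S x))) = S`.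
[cite: AlonKrivelevichSudakov1998, §2.2–2.3 (correctness of Algorithms A and B)] -/
theorem decodeVertexSet_output_eq {S S' : Finset (Fin n)} {x : EdgeVec n} (hS'S : S' ⊆ S)
    (hU : IsUniqueMaxClique (graphOfEdgeVec (plant S x)) S)
    (hdegE : x ∉ badDeg S (S \ S')) (hnormE : x ∉ badNormAt S (seedNbhd S S' x))
    (hk64 : 64 * (12 * Real.sqrt (seedNbhd S S' x).card + 1) ≤ ((S \ S').card : ℝ))
    (ht : 32 * Real.sqrt (S \ S').card ≤ (2 : ℝ) ^ n) :
    decodeVertexSet n (output S'.card (n, encodeEdgeVec (plant S x))) = S := by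
  classical
  -- sizes
  have hκ1 : 1 ≤ (S \ S').card := by
    have h64 : (64 : ℝ) ≤ (S \ S').card := le_trans (by nlinarith [Real.sqrt_nonneg ((seedNbhd S S' x).card : ℝ)]) hk64
    have : (1 : ℝ) ≤ (S \ S').card := by linarith
    exact_mod_cast this
  have hk1 : 1 ≤ S.card := hκ1.trans (card_le_card sdiff_subset)
  have hκm : (S \ S').card ≤ (seedNbhd S S' x).card := card_le_card (sdiff_subset_seedNbhd hS'S x)
  have hmn : (seedNbhd S S' x).card ≤ n := (card_le_univ _).trans (by rw [Fintype.card_fin])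
  -- the spectral core on the pulled-back graph
  obtain ⟨j, -, hj⟩ := spectral_core (nbhdGraph(S, S', x)) (card_plantedPos hS'S) isClique_plantedPos
    (by positivity) (spike_hR_of_not_mem_badNormAt hnormE) (hdeg_of_not_mem_badDeg hS'S hdegE)
    hk64 (t := n) ht
  -- the program's selection for column `j` and size `κ`
  set y := powerCol n (encodeEdgeVec (plant S x)) (nbhdList(S, S', x)) j n with hy
  set Wl := topPositions y (S \ S').card with hWl
  have hylen : y.length = (seedNbhd S S' x).card := by
    rw [hy, length_powerCol, length_nbhdList]
  obtain ⟨hWlen, hWnd, hWlt⟩ := topPositions_spec y (show (S \ S').card ≤ y.length by rw [hylen]; exact hκm)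
  rw [← hWl] at hWlen hWnd hWlt
  have hWlt' : ∀ b ∈ Wl, b < (seedNbhd S S' x).card := fun b hb => hylen ▸ hWlt b hb
  have hWcard : (finsetOfList((seedNbhd S S' x).card, Wl)).card = (S \ S').card := by
    rw [card_finsetOfList Wl hWnd hWlt', hWlen]
  have htop : ∀ i ∈ finsetOfList((seedNbhd S S' x).card, Wl),
      ∀ l, l ∉ finsetOfList((seedNbhd S S' x).card, Wl) →
      |(signMatrix (nbhdGraph(S, S', x)) ^ n) l j| ≤ |(signMatrix (nbhdGraph(S, S', x)) ^ n) i j| := by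
    intro i hi l hl
    rw [mem_finsetOfList] at hi hl
    rw [← powerCol_nbhdList_getD S S' x n l j, ← powerCol_nbhdList_getD S S' x n i j, ← hy]
    exact abs_le_of_mem_topPositions y (hWl ▸ hi) (by rw [hylen]; exact l.isLt) (hWl ▸ hl)
  have hfilter := hj (finsetOfList((seedNbhd S S' x).card, Wl)) hWcard htop
  -- the good candidate
  obtain ⟨hCset, -, hClen, hCcl⟩ := good_candidate hS'S hWlt' hWnd hfilter hWl
  -- the selection
  have hbest : (best n S'.card (encodeEdgeVec (plant S x))).toFinset = S.map Fin.valEmbedding := by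
    refine best_toFinset_eq hk1 ⟨_, ?_, hCcl, hClen⟩ (fun C hC hcl => (clique_candidate_le hU hC hcl).1)
      (fun C hC hcl => (clique_candidate_le hU hC hcl).2)
    rw [mem_candidates_iff]
    refine ⟨seedList(S'), seedList_mem_tuples S', j, lt_of_lt_of_le j.isLt hmn, (S \ S').card - 1,
      ?_, by rw [Nat.sub_add_cancel hκ1]⟩
    have : (S \ S').card ≤ n := hκm.trans hmn
    omega
  -- decoding
  rw [decodeVertexSet_output]
  ext i
  rw [mem_filter, ← List.mem_toFinset, hbest, Finset.mem_map]
  constructor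
  · rintro ⟨-, z, hz, hzi⟩
    have : z = i := Fin.ext hzi
    exact this ▸ hz
  · intro hi
    exact ⟨mem_univ _, i, hi, rfl⟩

end AKSProg

end Literature.Probability.RandomGraphs.PlantedClique

end
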